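import Summits.Ventures.PercRepro.RankLevelSetRuleQNineCert
import Summits.Ventures.PercRepro.RankLevelSetRuleQNineCore


/-!
# PercRepro — THE FAMILY `k = 9` ON ITS WHOLE UNTRUNCATED REGIME, FOR EVERY `q` (p4, gen 25; C-044; paper
proofs/P4-CELL-THREE.md §13.5, §13.7)

**`rhat_nine_whole (q m : ℕ) (hm : m + 8 ≤ q) : phiK (q + 9) q ≤ rhat q 9 m`** — Rule Q's equal split pays `Φ(q+9, q)` to
EVERY member of EVERY cell `(q+9, q)` with `#P ≤ q − 8` (the whole untruncated regime `u = q − #P ≥ k − 1`), uniformly in `q`.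
The same proof as RankLevelSetRuleQFiveWhole (paper §13): `(R̂ − Φ)·den = na·S(q,m) + nb` (**`rhat_nine_key`**) with the master
sum `S` of RankLevelSetRuleQSumS, the two-sided continued-fraction bounds `C_15 ≤ S ≤ C_13` (`C_15` resp. `C_13` from the
tree or proved as a sub- or super-solution of the recurrence), and the two certificates `na·C_15 + nb ≥ 0`,
`na·C_13 + nb ≥ 0` (polynomials with non-negative coefficients in `(q−m−8, m)`).  No `sorry`; axioms standard.
-/

namespace PercRepro

open Finset

/-- The lower certificate is non-negative for `a, b ≥ 0`. -/
lemma nine_lower_cert_nonneg (a b : ℚ) (ha : 0 ≤ a) (hb : 0 ≤ b) :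
    0 ≤ naNine (a + b + 8) b * cfFifteenN (a + b + 8) b + nbNine (a + b + 8) b * cfFifteenD (a + b + 8) b := by
  rw [nine_lower_cert]; exact (add_nonneg (add_nonneg (nineLowerCert1_nonneg a b ha hb) (nineLowerCert2_nonneg a b ha hb)) (nineLowerCert3_nonneg a b ha hb))

/-- The upper certificate is non-negative for `a, b ≥ 0`. -/
lemma nine_upper_cert_nonneg (a b : ℚ) (ha : 0 ≤ a) (hb : 0 ≤ b) :
    0 ≤ naNine (a + b + 8) b * cfThirteenN (a + b + 8) b + nbNine (a + b + 8) b * cfThirteenD (a + b + 8) b := by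
  rw [nine_upper_cert]; exact (add_nonneg (add_nonneg (nineUpperCert1_nonneg a b ha hb) (nineUpperCert2_nonneg a b ha hb)) (nineUpperCert3_nonneg a b ha hb))

/-- `na·C_15 + nb ≥ 0` on the untruncated regime. -/
lemma nine_lower_nonneg (q m : ℕ) (hm : m + 8 ≤ q) :
    0 ≤ naNine q m * (cfFifteenN q m / cfFifteenD q m) + nbNine q m := by
  have hD := cfFifteenD_pos q m (by positivity) (by exact_mod_cast (show m + 1 ≤ q by omega))
  have ha : (0 : ℚ) ≤ (q : ℚ) - m - 8 := by
    have : ((m + 8 : ℕ) : ℚ) ≤ q := by exact_mod_cast hm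
    push_cast at this; linarith
  have key := nine_lower_cert_nonneg ((q : ℚ) - m - 8) m ha (by positivity)
  rw [show (q : ℚ) - m - 8 + m + 8 = q by ring] at key
  have e : naNine q m * (cfFifteenN q m / cfFifteenD q m) + nbNine q m
      = (naNine q m * cfFifteenN q m + nbNine q m * cfFifteenD q m) / cfFifteenD q m := by
    rw [eq_div_iff hD.ne']; ring_nf; field_simp
  rw [e]
  exact div_nonneg key hD.le

/-- `na·C_13 + nb ≥ 0` on the untruncated regime. -/
lemma nine_upper_nonneg (q m : ℕ) (hm : m + 8 ≤ q) :
    0 ≤ naNine q m * (cfThirteenN q m / cfThirteenD q m) + nbNine q m := by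
  have hD := cfThirteenD_pos q m (by positivity) (by exact_mod_cast (show m + 1 ≤ q by omega))
  have ha : (0 : ℚ) ≤ (q : ℚ) - m - 8 := by
    have : ((m + 8 : ℕ) : ℚ) ≤ q := by exact_mod_cast hm
    push_cast at this; linarith
  have key := nine_upper_cert_nonneg ((q : ℚ) - m - 8) m ha (by positivity)
  rw [show (q : ℚ) - m - 8 + m + 8 = q by ring] at key
  have e : naNine q m * (cfThirteenN q m / cfThirteenD q m) + nbNine q m
      = (naNine q m * cfThirteenN q m + nbNine q m * cfThirteenD q m) / cfThirteenD q m := by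
    rw [eq_div_iff hD.ne']; ring_nf; field_simp
  rw [e]
  exact div_nonneg key hD.le

/-- **THE FAMILY `k = 9` ON ITS WHOLE UNTRUNCATED REGIME, FOR EVERY `q`**: `Φ(q+9, q) ≤ R̂(q, 9, m)` for every `m ≤ q − 8`. -/
theorem rhat_nine_whole (q m : ℕ) (hm : m + 8 ≤ q) : phiK (q + 9) q ≤ rhat q 9 m := by
  have hkey := rhat_nine_key q m hm
  have hden := denNine_pos q m
  have hlo := cfFifteen_le_sumS q m (by omega)
  have hhi := sumS_le_cfThirteen q m (by omega)
  have hL := nine_lower_nonneg q m hm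
  have hU := nine_upper_nonneg q m hm
  have hmain : 0 ≤ naNine q m * sumS q m + nbNine q m := by
    rcases le_total 0 (naNine q m) with hA | hA
    · calc (0 : ℚ) ≤ naNine q m * (cfFifteenN q m / cfFifteenD q m) + nbNine q m := hL
        _ ≤ naNine q m * sumS q m + nbNine q m := by
          gcongr
    · calc (0 : ℚ) ≤ naNine q m * (cfThirteenN q m / cfThirteenD q m) + nbNine q m := hU
        _ ≤ naNine q m * sumS q m + nbNine q m := by
          have := mul_le_mul_of_nonpos_left hhi hA
          linarith
  rw [← sub_nonneg]
  rw [← hkey] at hmain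
  exact nonneg_of_mul_nonneg_left hmain hden

/-- The matroid form: Rule Q's equal split pays `Φ(q+9,q)` to every member of every cell `(q+9, q)` with `#P ≤ q − 8`
(the whole untruncated regime of the family `k = 9`), for every `q`. -/
theorem ruleQRecv_ge_nine_whole (q m : ℕ) (hm : m + 8 ≤ q) : phiK (q + 9) q ≤ rhat q 9 m :=
  rhat_nine_whole q m hm

end PercRepro
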